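import Summits.QuantumFields.QCD.Theses.QuarksNoInfraredClause
import Summits.QuantumFields.QCD.Theses.CounterexampleMustBeHot
import Literature.MathematicalPhysics.QuantumFieldTheory.QCDFlavourSymmetry
import Summits.QuantumFields.QCD.Theorems.RobustYangMillsHandover.Negative.GapClauses
import HarnessLib

/-!
# Crux `ThinQCD` (item stmt-QuantumFields-17278, route route-QuantumFields-QuarksNoInfraredClause) from the thin lattice
# anchor and FOUR filed items of the tree — the kernel-checked upper bracket of line `registered` (reshape r3)

`thinQCD_of_convergentOSClosure`:

  (thin lattice anchor) → `TorusHalfSpectrum` (stmt-9508) → `ChiralCalibratedConvergence` (stmt-18044) →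
    `ConvergentOSClosure` (stmt-11525) → `RotationRestoration` (stmt-8840) → `ThinQCD`,

where the thin lattice anchor is the registered stub `stub_latticeAnchor` of the crux's skeleton (r3/r4): for `N_f = 2, 3` one
regularisation with leading-log mass scaling, `IsChiralAtZero`, two-loop asymptotic scaling and, at every positive mass
tuple, the physical branch and a volume-uniform lattice gap in the FLAVOUR-NEUTRAL sector.  The three sibling items are the
copies declared in `Theses/CounterexampleMustBeHot.lean` (bodies identical to the `GapBuysCauchyRate` / `DiagonalSpine`
copies).  Proof: HALF turns each neutral gap `Δ₀(m)` into the full lattice gap `Δ₀/2` (`chiralLatticeHalf_of_half`), so the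
anchor's regularisation carries the chiral lattice half; the UV law returns a reindexed regularisation (volumes only enlarged,
chirality re-derived) with ONE calibrated species family, calibrations, the glue κ₃ window and full convergence at every
positive tuple; mass scaling / asymptotic scaling / branch / gap are transported; `ConvergentOSClosure` closes the limit with
the continuum gap AT the lattice rate, `RotationRestoration` restores E1, the packaging clause gives `T : OSData`; the crux's
two 2-point UV windows are the calibration identities at the reference pair `(Θf₀, f₀)` (`ε = 1`, one-point functions
subtracted), its 3-point window is the κ₃ clause, `T.HasMassGap (Δ/2)` by antitonicity, and its neutral lattice clause at
rate `2·(Δ/2)` is the lattice gap restricted to neutral pairs.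

Status of the hypotheses (2026-08-17): all four items open; `ConvergentOSClosure` is flagged misstated by its own lead
(hypotheses idle; repaired form R′ proved in `Cruxes/ConvergentOSClosure/Restatement.lean`) — the crux's registered skeleton
r4 (`Cruxes/ThinQCD/Lines/birth.lean`) therefore inlines R′ and exposes the lattice-side inputs T∧COMP / CL / CS instead; this
file records the shorter item-level bracket.  No definition, no named fact, no `sorry`.
-/

noncomputable section

namespace Summit.QuantumFields.QCD.Cruxes.ThinQCD.Registered

open scoped Topology SchwartzMap
open Filter
open Literature.MathematicalPhysics.QuantumFieldTheory Literature.MathematicalPhysics.QuantumLattice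
  Literature.MathematicalPhysics.AQFT
open Summit.QuantumFields.QCD.Theses
open Summit.QuantumFields.QCD.Theorems.RobustYangMillsHandover.Negative (hasMassGap_anti)

variable {Nf : ℕ}

/-- `b₀ > 0` for the two flavour numbers of the Statement. [folklore] -/
theorem betaCoeff₀_pos_of_two_or_three (hNf : Nf = 2 ∨ Nf = 3) : 0 < betaCoeff₀ Nf := by
  rcases hNf with rfl | rfl <;>
    · unfold Literature.MathematicalPhysics.QuantumFieldTheory.betaCoeff₀; positivity

/-- A one-element string written with `![·]` is the constant string. [folklore] -/
theorem vecCons_one_eq_const {α : Type} (s : α) : (![s] : Fin 1 → α) = fun _ => s := by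
  funext i; fin_cases i; rfl

/-- **HALF turns the thin anchor's neutral gap into the chiral lattice half** at one regularisation: at each positive tuple
the neutral lattice gap `Δ₀ = 2·(Δ₀/2)` of `reg.scheme m 0 0` (asymptotically scaling, on the physical branch, `b₀(N_f) > 0`)
is a full lattice gap `Δ₀/2` by `TorusHalfSpectrum`. [folklore] -/
theorem chiralLatticeHalf_of_half (hH : QuarksNoInfraredClause.TorusHalfSpectrum) (hNf : Nf = 2 ∨ Nf = 3)
    {reg : QCDRegularisation Nf} (has : (reg.scheme 0 0 0).HasAsymptoticScaling)
    (hgap : ∀ m : Fin Nf → ℝ, (∀ f, 0 < m f) →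
      (∀ f, ∀ᶠ k in atTop, (-1 : ℝ) < (reg.scheme m 0 0).mq f k) ∧
        ∃ Δ₀ : ℝ, 0 < Δ₀ ∧ (reg.scheme m 0 0).HasNeutralLatticeMassGap Δ₀) :
    ∀ m : Fin Nf → ℝ, (∀ f, 0 < m f) →
      (∀ f, ∀ᶠ k in Filter.atTop, -1 < (reg.scheme m 0 0).mq f k) ∧ ∃ Δ > 0, (reg.scheme m 0 0).HasLatticeMassGap Δ := by
  intro m hm
  obtain ⟨hbr, Δ₀, hΔ₀, hN⟩ := hgap m hm
  have has_m : (reg.scheme m 0 0).HasAsymptoticScaling := by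
    obtain ⟨Λ, hΛ, ht⟩ := has
    exact ⟨Λ, hΛ, ht⟩
  have h2 : (reg.scheme m 0 0).HasNeutralLatticeMassGap (2 * (Δ₀ / 2)) := hN.mono (by linarith)
  refine ⟨hbr, Δ₀ / 2, by positivity,
    hH Nf (reg.scheme m 0 0) (Δ₀ / 2) (by positivity) (betaCoeff₀_pos_of_two_or_three hNf) has_m hbr ?_⟩
  intro R R' A B hAn hBn
  exact h2 R R' A B hAn hBn

/-- **`ThinQCD` from the thin lattice anchor and four filed items** (HALF stmt-9508, the UV law stmt-18044, OS closure
stmt-11525, E1 stmt-8840) — the item-level upper bracket of the crux along line `registered`, kernel-checked.  See the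
module docstring for the walk-through. -/
theorem thinQCD_of_convergentOSClosure : (∀ Nf : ℕ, Nf = 2 ∨ Nf = 3 → ∃ reg : QCDRegularisation Nf, reg.HasMassScaling ∧ reg.IsChiralAtZero ∧ (reg.scheme 0 0 0).HasAsymptoticScaling ∧ ∀ m : Fin Nf → ℝ, (∀ f, 0 < m f) → (∀ f, ∀ᶠ k in atTop, (-1 : ℝ) < (reg.scheme m 0 0).mq f k) ∧ ∃ Δ₀ : ℝ, 0 < Δ₀ ∧ (reg.scheme m 0 0).HasNeutralLatticeMassGap Δ₀) → QuarksNoInfraredClause.TorusHalfSpectrum → CounterexampleMustBeHot.ChiralCalibratedConvergence → CounterexampleMustBeHot.ConvergentOSClosure → CounterexampleMustBeHot.RotationRestoration → QuarksNoInfraredClause.ThinQCD := by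
  intro hA hH hC hO hR Nf hNf
  -- the thin anchor; HALF: the chiral lattice half
  obtain ⟨reg, hms, hchi, has, hgap⟩ := hA Nf hNf
  have H := chiralLatticeHalf_of_half hH hNf has hgap
  -- the UV law along a reindexing
  obtain ⟨φ, reg₁, hφ, ha, hβ, hmc, hZm, hL, hchi₁, 𝒞, H₁⟩ := hC Nf hNf reg hms hchi has H
  -- leading-log mass scaling rides along the subsequence (reads `a`, `Z_m` only)
  have hms₁ : reg₁.HasMassScaling := by
    obtain ⟨c, hc, ht⟩ := hms
    refine ⟨c, hc, ?_⟩
    have hfun : (fun k => reg₁.Zm k / Real.log (1 / reg₁.a k ^ 2) ^ massExponent Nf) =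
        (fun k => reg.Zm k / Real.log (1 / reg.a k ^ 2) ^ massExponent Nf) ∘ φ := by
      funext k; simp [ha, hZm]
    rw [hfun]
    exact ht.comp hφ.tendsto_atTop
  refine ⟨reg₁, hms₁, hchi₁, fun m hm => ?_⟩
  obtain ⟨hbr, Δ, hΔ, hgapm⟩ := H m hm
  obtain ⟨h2g, h2q, h3g, hconv⟩ := H₁ m hm
  -- two-loop asymptotic scaling rides along (reads `β`, `a` only)
  have has₁ : (𝒞.scheme m).HasAsymptoticScaling := by
    obtain ⟨Λ, hΛ, ht⟩ := has
    refine ⟨Λ, hΛ, ?_⟩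
    have hfun : (fun k => (𝒞.scheme m).β k - afBeta Nf Λ ((𝒞.scheme m).a k)) =
        (fun k => (reg.scheme 0 0 0).β k - afBeta Nf Λ ((reg.scheme 0 0 0).a k)) ∘ φ := by
      funext k
      simp [QCDRegularisation.scheme, CalibratedSpeciesFamily.scheme, ha, hβ]
    rw [hfun]
    exact ht.comp hφ.tendsto_atTop
  -- the physical branch rides along (reads `m_crit`, `a`, `Z_m`)
  have hbr₁ : ∀ fl : Fin Nf, ∀ᶠ k in Filter.atTop, -1 < (𝒞.scheme m).mq fl k := by
    intro fl
    refine (hφ.tendsto_atTop.eventually (hbr fl)).mono fun k hk => ?_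
    simpa [ha, hmc, hZm] using hk
  -- the uniform lattice gap rides along and survives the volume ENLARGEMENT (all tori `S ≥ L_k` are quantified)
  have hgap₁ : (𝒞.scheme m).HasLatticeMassGap Δ := by
    intro R R' A B
    obtain ⟨C, hC⟩ := hgapm R R' A B
    refine ⟨C, (hφ.tendsto_atTop.eventually hC).mono fun k hk S hS n hn => ?_⟩
    have hS' : (reg.scheme m 0 0).L (φ k) ≤ S :=
      (hL k).trans (by simpa [CalibratedSpeciesFamily.scheme, QCDRegularisation.scheme] using hS)
    simpa [QCDRegularisation.scheme, CalibratedSpeciesFamily.scheme, ha, hβ, hmc, hZm] using hk S hS' n hn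
  -- OS closure of the convergent calibrated family; rotations; packaging
  obtain ⟨S, -, -, -, -, -, -, -, hConvS, ⟨Δ', hΔ', hGapS, hGapL⟩, hPack⟩ :=
    hO Nf reg₁ 𝒞 m hm has₁ hbr₁ ⟨Δ, hΔ, hgap₁⟩ h2g h2q h3g hconv
  have hE1 := hR Nf (𝒞.scheme m) has₁ hbr₁ ⟨Δ', hΔ', hGapL⟩ S hConvS
  obtain ⟨T, hTS, -, -, -⟩ := hPack hE1
  subst hTS
  -- the crux body at `m`
  refine ⟨𝒞.z m, 𝒞.shift m, T, ⟨has₁, hbr₁, hConvS⟩, ?_, ?_, h3g, Δ' / 2, half_pos hΔ',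
    hasMassGap_anti T (show Δ' / 2 ≤ Δ' by linarith) hGapS,
    hGapL.neutral.mono (show 2 * (Δ' / 2) ≤ Δ' by linarith)⟩
  · -- 2-point window of `glue`: the glue calibration at the reference pair (value `1`, one-point functions subtracted)
    refine ⟨thetaTest 4 𝒞.f₀, 𝒞.f₀, fun x hx => ?_, fun x hx => ?_, 1, one_pos, h2g.mono fun k hk => ?_⟩
    · have h := (mem_timeSlab.1 (𝒞.tsupport_thetaTest_f₀ hx)).2
      show x 0 < 0
      linarith [𝒞.τ₀_pos]
    · have h := (mem_timeSlab.1 (𝒞.tsupport_f₀ hx)).1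
      show 0 < x 0
      linarith [𝒞.τ₀_pos]
    · have h1 : qcdLatticeSchwinger (reg₁.scheme m (𝒞.z m) (𝒞.shift m)) k 1 ![QCDField.glue]
          ![thetaTest 4 𝒞.f₀] = 0 := by
        rw [vecCons_one_eq_const, vecCons_one_eq_const]; exact 𝒞.onePoint_eq_zero m _ k _
      have h2 : qcdLatticeSchwinger (reg₁.scheme m (𝒞.z m) (𝒞.shift m)) k 2
          ![QCDField.glue, QCDField.glue] ![thetaTest 4 𝒞.f₀, 𝒞.f₀] = 1 := hk
      rw [h2, h1, zero_mul, sub_zero, norm_one]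
  · -- 2-point windows of the flavour-changing `pseudoRe f₁ f₂`: the `pseudoRe` calibration
    intro f₁ f₂ hne
    refine ⟨thetaTest 4 𝒞.f₀, 𝒞.f₀, fun x hx => ?_, fun x hx => ?_, 1, one_pos,
      (h2q f₁ f₂ hne).mono fun k hk => ?_⟩
    · have h := (mem_timeSlab.1 (𝒞.tsupport_thetaTest_f₀ hx)).2
      show x 0 < 0
      linarith [𝒞.τ₀_pos]
    · have h := (mem_timeSlab.1 (𝒞.tsupport_f₀ hx)).1
      show 0 < x 0
      linarith [𝒞.τ₀_pos]
    · have h1 : qcdLatticeSchwinger (reg₁.scheme m (𝒞.z m) (𝒞.shift m)) k 1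
          ![QCDField.pseudoRe f₁ f₂] ![thetaTest 4 𝒞.f₀] = 0 := by
        rw [vecCons_one_eq_const, vecCons_one_eq_const]; exact 𝒞.onePoint_eq_zero m _ k _
      have h2 : qcdLatticeSchwinger (reg₁.scheme m (𝒞.z m) (𝒞.shift m)) k 2
          ![QCDField.pseudoRe f₁ f₂, QCDField.pseudoRe f₁ f₂] ![thetaTest 4 𝒞.f₀, 𝒞.f₀] = 1 := hk
      rw [h2, h1, zero_mul, sub_zero, norm_one]

end Summit.QuantumFields.QCD.Cruxes.ThinQCD.Registered

end
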